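import Literature.NumberTheory.EllipticCurves.KrausOesterle1992.TorsionCongruenceCriterion
import HarnessLib

/-!
# Kraus–Oesterlé 1992, Proposition 4, (ii) ⇒ (i) — the print-faithful twin in Hasse–Weil currency

A. Kraus, J. Oesterlé, *Sur une question de B. Mazur*, Math. Ann. **293** (1992) 259–275
(doi 10.1007/BF01444715; bib `KrausOesterle1992`), §3 and Proposition 4. Statement file of the
story `KrausOesterle1992/` (topic `NumberTheory/EllipticCurves`): ONE named fact (D-0014) — the
twin `prop4_torsionIso_of_congruences_hasseWeil` of the registered fact A30
`prop4_torsionIso_of_congruences` (sibling `TorsionCongruenceCriterion.lean`) — plus PROVED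
forwarders and bridges; no new definition besides the fact. Typed by the cross-ladder
literature-typing layer (cell `pub/bsd-littype`, seat bsd-littype-07 g6) on the ARM-P target
T-Q41-1 (cell `pub/bsd-cited`, RULING (307), REGISTER R-20 «KO92-Prop4-(ii)b-frobeniusTrace-offset»;
reader sheet `pub/bsd-cited/sheets/D-AUDIT-r07-Q41-KO92-LS18.md` d816b43f675df775 §V1/§V4 +
ADDENDUM-1 1f56f43c699071c8). HONEST FRAMING: this file proves nothing about BSD; it re-types one
published criterion in the currency the paper prints, so that the ≈ 216 record theorems that
display its hypothesis list (b2b-bsdres X11b `CongruentSelmerTransfer*Records`, X9/X10/X11a/O5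
partner roads, potss Σ-road) can display a SATISFIABLE list; typed ≠ proved ≠ endorsed.

## Why a twin (the finding F1 of the reader sheet, numbers not adjectives)

A30 transcribes clause (ii) of Proposition 4 with `a_ℓ := W.frobeniusTrace ℓ` (the tree's
`ℓ + 1 − #Ẽ_ns(𝔽_ℓ)` on the global minimal model, `GlobalMinimalModel`). At a prime `ℓ` of GOOD
reduction this IS the Hasse–Weil coefficient (`WeierstrassCurve.LFunction_apply_prime_eq_frobeniusTrace`,
PROVED, `LFunctionPrimeCoeff`), so the first conjunct of (ii) («`ℓ ∤ NN'` ⇒ `a_ℓ ≡ a'_ℓ`») is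
print-faithful in either spelling. But in the second conjunct («`ℓ ∣ NN'`, `ℓ² ∤ NN'` ⇒
`a_ℓ a'_ℓ ≡ ℓ + 1`») exactly one of the two curves is MULTIPLICATIVE at `ℓ`, and there the tree's
`frobeniusTrace` is `ℓ + 1 − #Ẽ_ns(𝔽_ℓ) = 2` (split) or `0` (non-split)
(`Literature.NumberTheory.EllipticCurves.reductionPointCount_of_mult`, PROVED; Silverman AEC
Ex. 3.5), i.e. `1 + a_ℓ`, whereas the paper's `a_ℓ` is the Hasse–Weil coefficient `±1`
(p. 262 §3: *"Notons `N` et `N'` leurs conducteurs, `∑ a_n n^{-s}` et `∑ a'_n n^{-s}` leurs fonctions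
`L` de Hasse–Weil"*; p. 262 Lemme 1: *"Si `E` a réduction multiplicative déployée en `ℓ`, on a
`a_ℓ = 1` … non déployée en `ℓ`, on a `a_ℓ = −1`"*; p. 263 L8–9, proof of Prop. 3: *"Comme on a
`a'_ℓ = ±1`, on a `a_ℓ a'_ℓ ≡ ℓ + 1 mod p`"*). So A30's displayed clause at such an `ℓ` reads
«`p ∣ 2a_ℓ − (ℓ+1)`» (split) or «`p ∣ ℓ + 1`» (non-split) instead of print's «`p ∣ a_ℓ a'_ℓ − (ℓ+1)`»,
`a'_ℓ = ±1`: a transcription slip, kernel-certified and witnessed numerically by the ARM-P reader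
(pair 2760k1 ↔ 6440i1, `p = 5`: print ✓✓, A30-as-typed ✗✗). A30 is therefore FAITHFUL exactly on
the pairs with NO prime `ℓ < μ(M)/6`, `v_ℓ(NN') = 1` («unexposed»), and NOT print's test on the
others («exposed»; 216 of the 217 concrete X11b record pairs). This file vendors print's clause
with Mathlib's `WeierstrassCurve.LFunction W : ArithmeticFunction ℤ` (T. Browning), whose
coefficient at a prime `ℓ` is the Hasse–Weil `a_ℓ` at EVERY prime — local factors
`1 − a_vT + q_vT²` (good), `1 − T` (split multiplicative), `1 + T` (non-split), `1` (additive),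
Silverman AEC §C.16 (`LFunctionPrimeCoeff.lean` l. 8–15; `= frobeniusTrace` at good primes,
`LFunction_apply_prime_eq_frobeniusTrace`; `= 1 / −1 / 0` at split / non-split / additive places,
`LFunction_apply_primesEquiv_of_…`, `RootNumberAtkinLehnerSemistableProofs`). Only the ONE token of
the `= 1 →` conjunct changes; the `= 0 →` conjunct keeps A30's spelling (there `frobeniusTrace` =
Hasse–Weil, both curves being good at `ℓ`), so that consumers re-key by a one-token template change
(ARM-P §V4: «a one-token template change + re-generation; their ENGINE evidence already tests
print's clause»). The old declaration is NOT touched (ARM-P target T-Q41-2 decides A30 as a closed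
`Prop` in the refuter lane; its docstring sentence :62–64 is DD-81, owner b2b-bsdres); there is NO
bridge A30 ⇒ twin or twin ⇒ A30 in general (different hypotheses) — only on unexposed pairs, where
the two hypothesis lists coincide literally (`congruenceList_hasseWeil_iff_of_noExposedPrime`,
PROVED below), so unexposed consumers (e.g. the potss SeedRowC road, `N_W = 25·N_G`: no simple
prime in `N_W N_G`) bridge BY NAME in either direction.

## The printed statement (PRIMARY, read first-hand on the open GDZ digitisation of Math. Ann. 293,
## PPN235181684_0293, article LOG_0024; scan `NNN` = printed p. `NNN − 6`; OCR text deposited by the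
## cell b2b-bsdres at run/shared/lean/b2b/bsd-rank1-residual/b2b-bsdres-n1011-lit/ko92-gdz-ocr/pNNN.txt,
## page-image crops at …/b2b-bsdres-lit/g7/ko92/)

§3, p. 262 (scan 268): *"Soient `E` et `E'` deux courbes elliptiques définies sur `ℚ`. Notons `N`
et `N'` leurs conducteurs, `∑ a_n n^{-s}` et `∑ a'_n n^{-s}` leurs fonctions `L` de Hasse–Weil. Soit
`p` un nombre premier. Notons `ρ` et `ρ'` les représentations de `Gal(ℚ̄/ℚ)` dans les groupes
`E_p(ℚ̄)` et `E'_p(ℚ̄)` des points de `p`-torsion"* — NO hypothesis on `p`.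
Proposition 4, pp. 263–264 (scans 269–270): *"Supposons que `E` et `E'` soient des courbes de Weil
(…). Notons `S` l'ensemble des nombres premiers `ℓ` en lesquels l'une des courbes a réduction
multiplicative déployée et l'autre réduction multiplicative non déployée. Posons
`M = ppcm(N, N') ∏_{ℓ∈S} ℓ` et `μ(M) = |ℙ¹(ℤ/Mℤ)| = M ∏_{ℓ∣M} (1 + ℓ⁻¹)`. Les conditions
suivantes sont équivalentes: (i) les représentations `ρ` et `ρ'` ont des semi-simplifiées
isomorphes; (ii) pour tout nombre premier `ℓ < μ(M)/6` ne divisant pas `NN'`, on a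
`a_ℓ ≡ a'_ℓ mod p`; pour tout nombre premier `ℓ < μ(M)/6` tel que `ℓ ∣ NN'` et `ℓ² ∤ NN'`, on a
`a_ℓ a'_ℓ ≡ ℓ + 1 mod p`."*; p. 265 (scan 271) L13–15: for `ρ`, `ρ'` irreducible, *"donc sont
isomorphes"*. «Courbes de Weil» = modular, now a theorem for every `E/ℚ` (BCDT 2001), as in A30.

## Faithfulness (hypotheses complete; weaker than print where it differs, never stronger)

Exactly A30's transcription (module docstring of `TorsionCongruenceCriterion.lean`, § faithfulness:
`W, W'` globally minimal elliptic over `ℚ` — harmless for `LFunction`, which is model-independent,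
and needed for `frobeniusTrace` / `conductorNorm`; `p` any prime; `M = modulus W W'`,
`μ(M) = gammaZeroIndex M`, «`ℓ < μ(M)/6`» ⟷ `6ℓ < μ(M)`; `v_ℓ(NN') = padicValNat ℓ (N·N')`,
`N = W.conductorNorm ℤ`; conclusion in the irreducible case only, as a `Γ_ℚ`-equivariant additive
isomorphism `E[p] ≃+ E'[p]` of `geomTorsion` — the special case «(ii) ∧ `E[p]` irreducible ⇒
`E[p] ≅ E'[p]`» of the printed equivalence) with the single change: in the `= 1 →` conjunct
`a_ℓ a'_ℓ := W.LFunction ℓ * W'.LFunction ℓ` (Hasse–Weil, as printed). VERBATIM on every clause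
(reader sheet §B Table 1 rows 1–5, 7 unchanged; row 6 now print's).
`-- TODO(general form): (i) ⇔ (ii) with semi-simplifications, once the tree has a`
`-- semi-simplification functor for 𝔽_p[Γ_ℚ]-modules (as for A30).`

## Contents

* `prop4_torsionIso_of_congruences_hasseWeil` — the NAMED FACT (PUB; net debt +1 by design).
* `torsionIso_of_congruences_hasseWeil` — PROVED forwarder in the shape of the sibling's
  `torsionIso_of_congruences` (the inverse direction `A[p] ≃ W[p]` consumed by the X9/X11 roads).
* `congruenceList_hasseWeil_iff_of_noExposedPrime` — PROVED: on a pair with no prime `ℓ`,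
  `6ℓ < μ(M)`, `v_ℓ(NN') = 1`, the Hasse–Weil list and A30's list are EQUIVALENT (the differing
  conjunct is vacuous on both sides); whence `torsionIso_of_congruences_hasseWeil_of_noExposedPrime`
  (the twin fed with an A30-currency list) and the two restricted comparisons
  `prop4_frobeniusTrace_of_hasseWeil_of_noExposedPrime` / `prop4_hasseWeil_of_frobeniusTrace_of_noExposedPrime`
  (twin ⇒ A30's statement on unexposed pairs, and conversely).
The `LFunction`-congruence forwarder (`lFunction_congr_of_prop4_hasseWeil`, shape of the sibling
Proofs file's `lFunction_congr_of_prop4`), the all-Hasse–Weil-list variant and the Literature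
restatement of the reader's kernel identities K3a–d (`LFunction = ±1`, `frobeniusTrace = LFunction + 1`
at a multiplicative prime) live in the companion `TorsionCongruenceCriterionHasseWeilProofs.lean`
(theorems only; heavier imports).

## References

* [KrausOesterle1992] A. Kraus, J. Oesterlé, Math. Ann. 293 (1992) 259–275: §3 p. 262 (setting,
  Hasse–Weil `L`-functions; Lemme 1: `a_ℓ = ±1` at a multiplicative `ℓ`), p. 263 L8–9 («Comme on a
  `a'_ℓ = ±1`»), Prop. 4 pp. 263–264, p. 265 L13–15 (irreducible ⇒ isomorphic); GDZ scans 268–271.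
* [SilvermanAEC2009] J. H. Silverman, *The Arithmetic of Elliptic Curves*, 2nd ed., §C.16 (local
  factors of `L(E/K, s)`), Ex. 8.19(a), Ex. 3.5.
* [Fisher2021SeventeenCongruent] T. Fisher, arXiv:2106.02033, Lemma 2.2 "(KO)" (restatement).
* ARM-P reader sheet `pub/bsd-cited/sheets/D-AUDIT-r07-Q41-KO92-LS18.md` (d816b43f675df775) §V1–V4,
  kernel `sheets/r07-Q41/d_audit_r07_Q41_check.lean` (K3a–d), witness `witness_2760k1_6440i1.py`.
-/


noncomputable section

open scoped Classical

open WeierstrassCurve Literature.NumberTheory.EllipticCurves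

namespace Literature.NumberTheory.EllipticCurves.KrausOesterle1992

/-! ### The named fact: Proposition 4, (ii) ⇒ (i), irreducible case, Hasse–Weil currency -/

/-- **Kraus–Oesterlé 1992, Proposition 4, (ii) ⇒ (i), case `E[p]` irreducible — print-faithful
twin of `prop4_torsionIso_of_congruences` (A30) in Hasse–Weil currency.** A. Kraus, J. Oesterlé,
*Sur une question de B. Mazur*, Math. Ann. 293 (1992) 259–275, Prop. 4 (pp. 263–264; PRIMARY read on
the GDZ scan of vol. 293, scans 269–270): for (modular) elliptic curves `E, E'/ℚ` of conductors
`N, N'` with Hasse–Weil `L`-functions `∑ a_n n^{-s}`, `∑ a'_n n^{-s}` (§3, p. 262), `p` ANY prime,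
`S` = the primes where one curve is split and the other non-split multiplicative,
`M = ppcm(N, N') ∏_{ℓ∈S} ℓ`, `μ(M) = |ℙ¹(ℤ/Mℤ)|`: (i) «`ρ`, `ρ'` ont des semi-simplifiées isomorphes»
⟺ (ii) «pour tout nombre premier `ℓ < μ(M)/6` ne divisant pas `NN'`, on a `a_ℓ ≡ a'_ℓ mod p`; pour
tout nombre premier `ℓ < μ(M)/6` tel que `ℓ ∣ NN'` et `ℓ² ∤ NN'`, on a `a_ℓ a'_ℓ ≡ ℓ + 1 mod p`»,
where at such an `ℓ` one curve is multiplicative with `a_ℓ = ±1` (p. 262 Lemme 1; p. 263 L8–9 «Comme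
on a `a'_ℓ = ±1`»). Transcription = A30's (module docstring), i.e. `W, W'` globally minimal, `p`
prime, `W[p]` IRREDUCIBLE (extra hypothesis, under which (i) is an isomorphism `E[p] ≅ E'[p]`,
p. 265 L13–15), the list (ii) for all primes `ℓ` with `6ℓ < μ(M)` (`gammaZeroIndex (modulus W W')`),
`v_ℓ(NN') = padicValNat ℓ (N·N')`, `N = W.conductorNorm ℤ` — with, in the `v_ℓ(NN') = 1` conjunct,
`a_ℓ a'_ℓ := W.LFunction ℓ * W'.LFunction ℓ` (Mathlib's `WeierstrassCurve.LFunction`: prime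
coefficient = Hasse–Weil `a_ℓ` at every prime, `±1` at a multiplicative one), and, in the
`v_ℓ(NN') = 0` conjunct, `a_ℓ := frobeniusTrace ℓ` as in A30 (= Hasse–Weil at a good prime,
`LFunction_apply_prime_eq_frobeniusTrace`). Conclusion: a `Γ_ℚ`-equivariant additive isomorphism
`E[p] ≃+ E'[p]`. Weaker than print (one direction, irreducible case), never stronger. Size M (Sturm
/ Appendice II + Čebotarev); no `_holds`.
[cite: KrausOesterle1992, Prop. 4 (ii) ⇒ (i), pp. 263–264; §3 p. 262 (Hasse–Weil coefficients, Lemme 1); p. 263 L8–9; p. 265 L13–15 — GDZ PPN235181684_0293 scans 268–271] -/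
def prop4_torsionIso_of_congruences_hasseWeil : Prop :=
  ∀ (W W' : WeierstrassCurve ℚ) [W.IsElliptic] [W.IsGloballyMinimal] [W'.IsElliptic]
    [W'.IsGloballyMinimal] (p : ℕ) [Fact p.Prime],
    W.HasIrreducibleModPGaloisRep p →
    (∀ (ℓ : ℕ) [Fact ℓ.Prime], 6 * ℓ < gammaZeroIndex (modulus W W') →
      (padicValNat ℓ (W.conductorNorm ℤ * W'.conductorNorm ℤ) = 0 →
          (p : ℤ) ∣ W.frobeniusTrace ℓ - W'.frobeniusTrace ℓ) ∧
        (padicValNat ℓ (W.conductorNorm ℤ * W'.conductorNorm ℤ) = 1 →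
          (p : ℤ) ∣ W.LFunction ℓ * W'.LFunction ℓ - (ℓ + 1))) →
    ∃ e : geomTorsion W (p : ℤ) ≃+ geomTorsion W' (p : ℤ),
      ∀ (σ : Field.absoluteGaloisGroup ℚ) (P : geomTorsion W (p : ℤ)), e (σ • P) = σ • e P

/-! ### Forwarder in the shape of the sibling's `torsionIso_of_congruences` -/

/-- **The finite Kraus–Oesterlé criterion (Hasse–Weil currency) in the direction the partner roads
consume.** For a globally minimal `W` with `W[p]` irreducible and a globally minimal partner `A`, the
congruence list of Prop. 4 (ii) below `μ(M)/6` — good-prime conjunct on `frobeniusTrace`, simple-prime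
conjunct on the Hasse–Weil coefficients `LFunction ℓ` — gives a `Γ_ℚ`-equivariant `A[p] ≃+ W[p]`
(the named fact `hKO`, then symmetry: the inverse of an equivariant isomorphism is equivariant).
Twin of `torsionIso_of_congruences`. [cite: KrausOesterle1992, Prop. 4 (ii) ⇒ (i), pp. 263–264] -/
theorem torsionIso_of_congruences_hasseWeil (hKO : prop4_torsionIso_of_congruences_hasseWeil)
    (W A : WeierstrassCurve ℚ) [W.IsElliptic] [W.IsGloballyMinimal] [A.IsElliptic]
    [A.IsGloballyMinimal] (p : ℕ) [Fact p.Prime] (hirr : W.HasIrreducibleModPGaloisRep p)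
    (hcong : ∀ (ℓ : ℕ) [Fact ℓ.Prime], 6 * ℓ < gammaZeroIndex (modulus W A) →
      (padicValNat ℓ (W.conductorNorm ℤ * A.conductorNorm ℤ) = 0 →
          (p : ℤ) ∣ W.frobeniusTrace ℓ - A.frobeniusTrace ℓ) ∧
        (padicValNat ℓ (W.conductorNorm ℤ * A.conductorNorm ℤ) = 1 →
          (p : ℤ) ∣ W.LFunction ℓ * A.LFunction ℓ - (ℓ + 1))) :
    ∃ e : geomTorsion A (p : ℤ) ≃+ geomTorsion W (p : ℤ),
      ∀ (σ : Field.absoluteGaloisGroup ℚ) (P : geomTorsion A (p : ℤ)), e (σ • P) = σ • e P := by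
  obtain ⟨e, he⟩ := hKO W A p hirr hcong
  refine ⟨e.symm, fun σ Q => e.injective ?_⟩
  rw [e.apply_symm_apply, he, e.apply_symm_apply]

/-! ### Unexposed pairs: the two hypothesis lists coincide -/

section NoExposedPrime

variable (W W' : WeierstrassCurve ℚ) [W.IsElliptic] [W.IsGloballyMinimal] [W'.IsElliptic]
  [W'.IsGloballyMinimal] (p : ℕ)

/-- **On a pair with no «exposed» prime the Hasse–Weil list and A30's list are the same
hypothesis.** If no prime `ℓ` with `6ℓ < μ(M)` has `v_ℓ(NN') = 1` (no prime divides `NN'` exactly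
once below the bound — e.g. `N_W = 25·N_G` on the potss SeedRowC rows, or any pair with `N·N'`
powerful), then the congruence list (ii) with the simple-prime conjunct over `LFunction` and the one
over `frobeniusTrace` are equivalent: the conjunct in which they differ is vacuous on both sides.
Pure logic; this is the by-name bridge for unexposed consumers (ARM-P sheet §V1: A30 is FAITHFUL
exactly there). [cite: KrausOesterle1992, Prop. 4 (ii), p. 264 L1–3] -/
theorem congruenceList_hasseWeil_iff_of_noExposedPrime
    (hno : ∀ (ℓ : ℕ) [Fact ℓ.Prime], 6 * ℓ < gammaZeroIndex (modulus W W') →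
      padicValNat ℓ (W.conductorNorm ℤ * W'.conductorNorm ℤ) ≠ 1) :
    (∀ (ℓ : ℕ) [Fact ℓ.Prime], 6 * ℓ < gammaZeroIndex (modulus W W') →
      (padicValNat ℓ (W.conductorNorm ℤ * W'.conductorNorm ℤ) = 0 →
          (p : ℤ) ∣ W.frobeniusTrace ℓ - W'.frobeniusTrace ℓ) ∧
        (padicValNat ℓ (W.conductorNorm ℤ * W'.conductorNorm ℤ) = 1 →
          (p : ℤ) ∣ W.LFunction ℓ * W'.LFunction ℓ - (ℓ + 1))) ↔
    (∀ (ℓ : ℕ) [Fact ℓ.Prime], 6 * ℓ < gammaZeroIndex (modulus W W') →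
      (padicValNat ℓ (W.conductorNorm ℤ * W'.conductorNorm ℤ) = 0 →
          (p : ℤ) ∣ W.frobeniusTrace ℓ - W'.frobeniusTrace ℓ) ∧
        (padicValNat ℓ (W.conductorNorm ℤ * W'.conductorNorm ℤ) = 1 →
          (p : ℤ) ∣ W.frobeniusTrace ℓ * W'.frobeniusTrace ℓ - (ℓ + 1))) := by
  constructor
  · intro h ℓ _ hℓ
    exact ⟨(h ℓ hℓ).1, fun h1 => absurd h1 (hno ℓ hℓ)⟩
  · intro h ℓ _ hℓ
    exact ⟨(h ℓ hℓ).1, fun h1 => absurd h1 (hno ℓ hℓ)⟩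

end NoExposedPrime

/-- **The twin fed with an A30-currency list on an unexposed pair.** For globally minimal `W, A`,
`W[p]` irreducible, no prime `ℓ` with `6ℓ < μ(M)`, `v_ℓ(N_W N_A) = 1`, and the congruence list in
`frobeniusTrace` currency (the list today's consumers display — potss
`…TameLowerFouquetRoadBCS` strict road, X9 CM partners with coprime-free conductors, …): a
`Γ_ℚ`-equivariant `A[p] ≃+ W[p]` from the Hasse–Weil fact. So such consumers re-key from A30 to the
twin BY NAME, adding only the (decidable, per-row) «no exposed prime» certificate.
[cite: KrausOesterle1992, Prop. 4 (ii) ⇒ (i), pp. 263–264] -/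
theorem torsionIso_of_congruences_hasseWeil_of_noExposedPrime
    (hKO : prop4_torsionIso_of_congruences_hasseWeil)
    (W A : WeierstrassCurve ℚ) [W.IsElliptic] [W.IsGloballyMinimal] [A.IsElliptic]
    [A.IsGloballyMinimal] (p : ℕ) [Fact p.Prime] (hirr : W.HasIrreducibleModPGaloisRep p)
    (hno : ∀ (ℓ : ℕ) [Fact ℓ.Prime], 6 * ℓ < gammaZeroIndex (modulus W A) →
      padicValNat ℓ (W.conductorNorm ℤ * A.conductorNorm ℤ) ≠ 1)
    (hcong : ∀ (ℓ : ℕ) [Fact ℓ.Prime], 6 * ℓ < gammaZeroIndex (modulus W A) →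
      (padicValNat ℓ (W.conductorNorm ℤ * A.conductorNorm ℤ) = 0 →
          (p : ℤ) ∣ W.frobeniusTrace ℓ - A.frobeniusTrace ℓ) ∧
        (padicValNat ℓ (W.conductorNorm ℤ * A.conductorNorm ℤ) = 1 →
          (p : ℤ) ∣ W.frobeniusTrace ℓ * A.frobeniusTrace ℓ - (ℓ + 1))) :
    ∃ e : geomTorsion A (p : ℤ) ≃+ geomTorsion W (p : ℤ),
      ∀ (σ : Field.absoluteGaloisGroup ℚ) (P : geomTorsion A (p : ℤ)), e (σ • P) = σ • e P :=
  torsionIso_of_congruences_hasseWeil hKO W A p hirr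
    ((congruenceList_hasseWeil_iff_of_noExposedPrime W A p hno).mpr hcong)

/-- **Twin ⇒ A30's statement on unexposed pairs.** The Hasse–Weil fact implies the statement of
`prop4_torsionIso_of_congruences` restricted to pairs with no prime `ℓ`, `6ℓ < μ(M)`,
`v_ℓ(NN') = 1` — the locus on which A30 is print-faithful (ARM-P sheet §V1). (No implication in
either direction is claimed on exposed pairs: the hypotheses differ there.)
[cite: KrausOesterle1992, Prop. 4 (ii) ⇒ (i), pp. 263–264] -/
theorem prop4_frobeniusTrace_of_hasseWeil_of_noExposedPrime
    (hKO : prop4_torsionIso_of_congruences_hasseWeil)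
    (W W' : WeierstrassCurve ℚ) [W.IsElliptic] [W.IsGloballyMinimal] [W'.IsElliptic]
    [W'.IsGloballyMinimal] (p : ℕ) [Fact p.Prime] (hirr : W.HasIrreducibleModPGaloisRep p)
    (hno : ∀ (ℓ : ℕ) [Fact ℓ.Prime], 6 * ℓ < gammaZeroIndex (modulus W W') →
      padicValNat ℓ (W.conductorNorm ℤ * W'.conductorNorm ℤ) ≠ 1)
    (hcong : ∀ (ℓ : ℕ) [Fact ℓ.Prime], 6 * ℓ < gammaZeroIndex (modulus W W') →
      (padicValNat ℓ (W.conductorNorm ℤ * W'.conductorNorm ℤ) = 0 →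
          (p : ℤ) ∣ W.frobeniusTrace ℓ - W'.frobeniusTrace ℓ) ∧
        (padicValNat ℓ (W.conductorNorm ℤ * W'.conductorNorm ℤ) = 1 →
          (p : ℤ) ∣ W.frobeniusTrace ℓ * W'.frobeniusTrace ℓ - (ℓ + 1))) :
    ∃ e : geomTorsion W (p : ℤ) ≃+ geomTorsion W' (p : ℤ),
      ∀ (σ : Field.absoluteGaloisGroup ℚ) (P : geomTorsion W (p : ℤ)), e (σ • P) = σ • e P :=
  hKO W W' p hirr ((congruenceList_hasseWeil_iff_of_noExposedPrime W W' p hno).mpr hcong)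

/-- **A30 ⇒ the twin's statement on unexposed pairs** (the converse comparison: on its faithful
locus the old fact already delivers the Hasse–Weil statement).
[cite: KrausOesterle1992, Prop. 4 (ii) ⇒ (i), pp. 263–264] -/
theorem prop4_hasseWeil_of_frobeniusTrace_of_noExposedPrime
    (hKO : prop4_torsionIso_of_congruences)
    (W W' : WeierstrassCurve ℚ) [W.IsElliptic] [W.IsGloballyMinimal] [W'.IsElliptic]
    [W'.IsGloballyMinimal] (p : ℕ) [Fact p.Prime] (hirr : W.HasIrreducibleModPGaloisRep p)
    (hno : ∀ (ℓ : ℕ) [Fact ℓ.Prime], 6 * ℓ < gammaZeroIndex (modulus W W') →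
      padicValNat ℓ (W.conductorNorm ℤ * W'.conductorNorm ℤ) ≠ 1)
    (hcong : ∀ (ℓ : ℕ) [Fact ℓ.Prime], 6 * ℓ < gammaZeroIndex (modulus W W') →
      (padicValNat ℓ (W.conductorNorm ℤ * W'.conductorNorm ℤ) = 0 →
          (p : ℤ) ∣ W.frobeniusTrace ℓ - W'.frobeniusTrace ℓ) ∧
        (padicValNat ℓ (W.conductorNorm ℤ * W'.conductorNorm ℤ) = 1 →
          (p : ℤ) ∣ W.LFunction ℓ * W'.LFunction ℓ - (ℓ + 1))) :
    ∃ e : geomTorsion W (p : ℤ) ≃+ geomTorsion W' (p : ℤ),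
      ∀ (σ : Field.absoluteGaloisGroup ℚ) (P : geomTorsion W (p : ℤ)), e (σ • P) = σ • e P :=
  hKO W W' p hirr ((congruenceList_hasseWeil_iff_of_noExposedPrime W W' p hno).mp hcong)

end Literature.NumberTheory.EllipticCurves.KrausOesterle1992

end
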